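import Literature.AlgebraicGeometry.HodgeTheory.NoTypeIVTimesCMProductSpan
import Literature.AlgebraicGeometry.HodgeTheory.Sl2IsotypicTimesCMDivisorClasses
import Literature.AlgebraicGeometry.HodgeTheory.RealMultiplicationHodgeGroupEqLefschetz
import Literature.AlgebraicGeometry.HodgeTheory.RealSl2Blocks
import Literature.AlgebraicGeometry.HodgeTheory.GenericAbelianSurfacePowersHodgeClasses
import Literature.AlgebraicGeometry.HodgeTheory.GenericAbelianThreefoldPowersHodgeClasses
import Literature.AlgebraicGeometry.HodgeTheory.SimpleAbelianSurfacePowersHodgeClasses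
import Literature.AlgebraicGeometry.HodgeTheory.SimpleAbelianThreefoldPowersHodgeClasses
import Literature.AlgebraicGeometry.Pohlmann1968.SimpleCMAbelianVarietyPowersDivisorGenerated
import HarnessLib

/-!
# Moonen–Zarhin 1999 Thm. (3.2)(2) as condition (D), PROVED in general: `A × C` is stably nondegenerate for `A` WITHOUT factor of Type IV satisfying (D) and `C` of CM type satisfying (D); the rows `S × E_k`, `T × E_k` (`End⁰ = ℚ` surface / threefold times a CM elliptic curve)

Family `hodge`, layer `Literature/AlgebraicGeometry/HodgeTheory`. Research context: cell `pub-hodge-ring2`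
(HONEST FRAMING: research route conditional on HC_CM; not a corollary; Q11.4-sentence-2 already refuted in
dim ≥ 3), Literature lane (lit seat, generation 52, programme R15 «CM curve × generic surface»). UNCONDITIONAL;
theorems only, no definition, no named fact, nothing here uses or asserts HC_CM; no step towards a summit statement.

PUBLISHED STATEMENT. Moonen–Zarhin, Math. Ann. 315 (1999), §3 Thm. (3.2) (after Hazama): «Let `X₁` and `X₂` be
complex abelian varieties which both satisfy condition (D) in (1.8). […] (2) Suppose `X₁` has no factors of Type 4
and `X₂` is of CM-type. Then `X₁ × X₂` again satisfies (D) and `Hg(X₁ × X₂) = Hg(X₁) × Hg(X₂)`»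
[corpus: paper:arxiv-math_9901113 p. 6]. Condition (D) (1.8): `B•(Xⁿ) = D•(Xⁿ)` for all `n` — the tree's
`IsStablyNondegenerate X` (Gordon's survey, Thm. 7.5 (1) and Def. 7.6: "stably nondegenerate").

THE PROOF IN THE TREE. The group statement of (2) is the tree's programme R5: for EVERY `A` without factor of
Type IV (`HasNoTypeIVFactor A`) and every `C` of CM type (`Milne1999.IsOfCMType C`) the Hodge classes of every
`A^{M+1} × C^{N+1}` are spanned by exterior products of Hodge classes of the factors
(`hodgeClassesProductSpan_powSucc_powSucc_of_hasNoTypeIVFactor`, `NoTypeIVTimesCMProductSpan`, the discharge of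
the named fact `Lombardo2016_hodgeClassesProductSpan`). Moonen–Zarhin §3, first paragraph: a product span with
both factors divisor-generated is divisor-generated, and `(A × C)^{N+1} ≅ A^{N+1} × C^{N+1}` — the tree's
`isStablyNondegenerate_prod_of_forall_productSpan_powSucc` (`Sl2IsotypicTimesCMDivisorClasses`). §1 below puts the
two together: **clause (2) of Thm. (3.2) as condition (D), for every `A` without factor of Type IV** (before this
file the tree had it for `A` a carrier of real `𝔰𝔩₂`-blocks, `RealSl2BlocksTimesCMDivisorClasses`, and for the
`𝔰𝔩₂`-isotypic class, `Sl2IsotypicTimesCMDivisorClasses`).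

RESULTS (all UNCONDITIONAL, no binder).
* §1 `IsStablyNondegenerate.prod_of_hasNoTypeIVFactor_of_isOfCMType` — Thm. (3.2)(2) as (D); mixed powers
  `A^{M+1} × C^{N+1}`, `B = D` on them, the Hodge conjecture for them and for everything isogenous to a power of
  `A × C`.
* §2 CM factors known to satisfy (D): `C` SIMPLE of CM type of dimension `≤ 3` (Pohlmann 1968 / Moonen–Zarhin (5.2),
  the tree's `isDivisorGenerated_powSucc_of_isSimple_of_isOfCMType_of_dim_le_three`) and `C = E` a CM elliptic
  curve (`EllipticCurve.isStablyNondegenerate`).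
* §3 ROWS of Moonen–Zarhin's Thm. 0.1 (4) now theorems: **`S × E`** for an abelian SURFACE `S` with `End⁰(S) = ℚ`
  (Type I(1), `Hg(S) = Sp₄`; the threefold row «CM elliptic curve × surface of Type I(1)», not an exceptional case
  (a) of Thm. 0.1 since `End⁰(S) = ℚ` contains no imaginary quadratic field) and a CM elliptic curve `E`; **`T × E`**
  for a THREEFOLD `T` with `End⁰(T) = ℚ`; `S × C`, `T × C` for `C` simple of CM type of dimension `≤ 3`; and the
  general simple surface / threefold without factor of Type IV times a CM elliptic curve. All mixed powers, `B = D`,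
  the Hodge conjecture, isogeny invariance.

## References
* [MoonenZarhin1999LowDim] B. Moonen, Yu. Zarhin, Math. Ann. 315 (1999) 711–733: (1.8) condition (D), §2 (2.2)–(2.3),
  §3 first paragraph, (3.1), Thm. (3.2)(2), §5 (5.2), Thm. 0.1 (4) [corpus: paper:arxiv-math_9901113 pp. 1, 4–6].
  [cite: MoonenZarhin1999LowDim, §3 Thm. (3.2)(2)]
* [Hazama1989] F. Hazama, Duke Math. J. 58 (1989) 31–37 (= Gordon 7.6.2). [cite: Hazama1989, Thm. (= Gordon 7.6.2)]
* [Lombardo2016] D. Lombardo, Algebra Number Theory 10 (2016), Lemma 3.4 (p. 1229). [cite: Lombardo2016, Lemma 3.4 (p. 1229)]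
* [Gordon1999HodgeAVSurvey] B. B. Gordon, App. B of Lewis (1999), Thm. 7.5 (1), Def. 7.6, Thm. 7.6.2. [cite: Gordon1999HodgeAVSurvey, Thm. 7.5 and Def. 7.6]
* [Pohlmann1968] H. Pohlmann, Ann. of Math. 88 (1968) 161–180, Thm. 1–2. [cite: Pohlmann1968, Thm. 2]
* [vanGeemen1994HodgeAV] B. van Geemen, LNM 1594 (1994), §2.4, Lemma 3.7, Thm. 4.3. [cite: vanGeemen1994HodgeAV, Lemma 3.7 and Thm. 4.3]
-/

noncomputable section

open CategoryTheory Module NumberField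

namespace Literature.AlgebraicGeometry.HodgeTheory

open Literature.AlgebraicGeometry.Motives (AbelianVariety)
open Literature.AlgebraicGeometry.ComplexMultiplication
open Literature.AlgebraicGeometry.Milne1999
open Literature.Barriers.HodgeConjecture
open Literature.AlgebraicGeometry.Pohlmann1968 (isDivisorGenerated_powSucc_of_isSimple_of_isOfCMType_of_dim_le_three)

/-! ### §1 Thm. (3.2)(2) as condition (D): no factor of Type IV times CM type -/

section General

variable {A C : AbelianVariety ℂ}

/-- **Moonen–Zarhin 1999 Thm. (3.2)(2), PROVED: `A × C` is stably nondegenerate** for `A` without factor of Type IV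
satisfying condition (D) and `C` of CM type satisfying condition (D) («Suppose `X₁` has no factors of Type 4 and `X₂`
is of CM-type. Then `X₁ × X₂` again satisfies (D)»): every `B((A × C)^{N+1}) = D((A × C)^{N+1})`. The product span
on all `A^{N+1} × C^{N+1}` is the tree's R5 (`hodgeClassesProductSpan_powSucc_powSucc_of_hasNoTypeIVFactor`), the
passage to (D) Moonen–Zarhin §3 first paragraph (`isStablyNondegenerate_prod_of_forall_productSpan_powSucc`).
[cite: MoonenZarhin1999LowDim, §3 Thm. (3.2)(2) and (3.1)] [cite: Lombardo2016, Lemma 3.4 (p. 1229)]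
[cite: Gordon1999HodgeAVSurvey, Thm. 7.5 (1) and Def. 7.6] -/
theorem IsStablyNondegenerate.prod_of_hasNoTypeIVFactor_of_isOfCMType (hA : IsStablyNondegenerate A)
    (hA4 : HasNoTypeIVFactor A) (hC : IsOfCMType C) (hCs : IsStablyNondegenerate C) :
    IsStablyNondegenerate (A.prod C) :=
  isStablyNondegenerate_prod_of_forall_productSpan_powSucc A C
    (fun N => hodgeClassesProductSpan_powSucc_powSucc_of_hasNoTypeIVFactor hA4 hC N N) hA hCs

/-- **All mixed powers `A^{M+1} × C^{N+1}` are stably nondegenerate** under the hypotheses of Thm. (3.2)(2)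
(retracts of powers of `A × C`). [cite: MoonenZarhin1999LowDim, §3 Thm. (3.2)(2)] [cite: Gordon1999HodgeAVSurvey, Def. 7.6] -/
theorem IsStablyNondegenerate.powSucc_prod_powSucc_of_hasNoTypeIVFactor_of_isOfCMType (hA : IsStablyNondegenerate A)
    (hA4 : HasNoTypeIVFactor A) (hC : IsOfCMType C) (hCs : IsStablyNondegenerate C) (M N : ℕ) :
    IsStablyNondegenerate ((A.powSucc M).prod (C.powSucc N)) :=
  (hA.prod_of_hasNoTypeIVFactor_of_isOfCMType hA4 hC hCs).powSucc_prod_powSucc M N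

/-- **`B(A^{M+1} × C^{N+1}) = D(A^{M+1} × C^{N+1})`** under the hypotheses of Thm. (3.2)(2).
[cite: MoonenZarhin1999LowDim, §3 Thm. (3.2)(2)] -/
theorem isDivisorGenerated_powSucc_prod_powSucc_of_hasNoTypeIVFactor_of_isOfCMType (hA : IsStablyNondegenerate A)
    (hA4 : HasNoTypeIVFactor A) (hC : IsOfCMType C) (hCs : IsStablyNondegenerate C) (M N : ℕ) :
    IsDivisorGenerated ((A.powSucc M).prod (C.powSucc N)) :=
  (hA.powSucc_prod_powSucc_of_hasNoTypeIVFactor_of_isOfCMType hA4 hC hCs M N).isDivisorGenerated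

/-- **The Hodge conjecture for every `A^{M+1} × C^{N+1}`** under the hypotheses of Thm. (3.2)(2) — UNCONDITIONAL
(`B = D` and Lefschetz `(1,1)`; no HC_CM hypothesis: `C` is assumed to satisfy (D), compare the tree's
`hodgeConjectureFor_powSucc_prod_of_hasNoTypeIVFactor_of_cmHodgeHypothesis`). [cite: MoonenZarhin1999LowDim, §2 condition (D) and §3 Thm. (3.2)(2)]
[cite: vanGeemen1994HodgeAV, §2.4] -/
theorem hodgeConjectureFor_powSucc_prod_powSucc_of_hasNoTypeIVFactor_of_isOfCMType_of_isStablyNondegenerate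
    (hA : IsStablyNondegenerate A) (hA4 : HasNoTypeIVFactor A) (hC : IsOfCMType C) (hCs : IsStablyNondegenerate C)
    (M N : ℕ) : HodgeConjectureFor ((A.powSucc M).prod (C.powSucc N)).dim ((A.powSucc M).prod (C.powSucc N)).X :=
  (hA.powSucc_prod_powSucc_of_hasNoTypeIVFactor_of_isOfCMType hA4 hC hCs M N).hodgeConjectureFor

/-- **The Hodge conjecture for everything isogenous to a power `(A × C)^{N+1}`** under the hypotheses of
Thm. (3.2)(2) (van Geemen's Lemma 3.7). [cite: vanGeemen1994HodgeAV, Lemma 3.7] [cite: MoonenZarhin1999LowDim, §3 Thm. (3.2)(2)] -/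
theorem hodgeConjectureFor_of_isIsogenous_powSucc_prod_of_hasNoTypeIVFactor_of_isOfCMType
    (hA : IsStablyNondegenerate A) (hA4 : HasNoTypeIVFactor A) (hC : IsOfCMType C) (hCs : IsStablyNondegenerate C)
    {X : AbelianVariety ℂ} {N : ℕ} (hX : AbelianVariety.IsIsogenous X ((A.prod C).powSucc N)) :
    HodgeConjectureFor X.dim X.X :=
  (hA.prod_of_hasNoTypeIVFactor_of_isOfCMType hA4 hC hCs).hodgeConjectureFor_of_isIsogenous_powSucc hX

/-- **Isogeny invariance**: everything isogenous to `A × C` is stably nondegenerate under the hypotheses of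
Thm. (3.2)(2). [cite: vanGeemen1994HodgeAV, §3.6 (p. 236)] [cite: MoonenZarhin1999LowDim, §3 Thm. (3.2)(2)] -/
theorem isStablyNondegenerate_of_isIsogenous_prod_of_hasNoTypeIVFactor_of_isOfCMType
    (hA : IsStablyNondegenerate A) (hA4 : HasNoTypeIVFactor A) (hC : IsOfCMType C) (hCs : IsStablyNondegenerate C)
    {X : AbelianVariety ℂ} (hX : AbelianVariety.IsIsogenous X (A.prod C)) : IsStablyNondegenerate X :=
  (hA.prod_of_hasNoTypeIVFactor_of_isOfCMType hA4 hC hCs).of_isIsogenous hX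

end General

/-! ### §2 CM factors satisfying (D): simple of dimension `≤ 3`, CM elliptic curves -/

section SmallCM

variable {A T E : AbelianVariety ℂ}

/-- **`A × T` is stably nondegenerate** for `A` without factor of Type IV satisfying (D) and `T` a SIMPLE abelian
variety of CM type of dimension `≤ 3` (every power of `T` has `B = D`: Pohlmann 1968 / Moonen–Zarhin (5.2), the
tree's `isDivisorGenerated_powSucc_of_isSimple_of_isOfCMType_of_dim_le_three`).
[cite: MoonenZarhin1999LowDim, §3 Thm. (3.2)(2) and §5 (5.2)] [cite: Pohlmann1968, Thm. 2] -/
theorem IsStablyNondegenerate.prod_of_hasNoTypeIVFactor_of_isSimple_of_isOfCMType_of_dim_le_three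
    (hA : IsStablyNondegenerate A) (hA4 : HasNoTypeIVFactor A) (hs : T.IsSimple) (h0 : 0 < T.dim) (h3 : T.dim ≤ 3)
    (hcm : IsOfCMType T) : IsStablyNondegenerate (A.prod T) :=
  hA.prod_of_hasNoTypeIVFactor_of_isOfCMType hA4 hcm fun N =>
    isDivisorGenerated_powSucc_of_isSimple_of_isOfCMType_of_dim_le_three T hs h0 h3 hcm N

/-- **`A × E` is stably nondegenerate** for `A` without factor of Type IV satisfying (D) and `E` an elliptic curve
with complex multiplication (`B(Eⁿ) = D(Eⁿ)`: `EllipticCurve.isStablyNondegenerate`) — Moonen–Zarhin (3.8)/(3.9)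
with (3.2)(2). [cite: MoonenZarhin1999LowDim, §3 Thm. (3.2)(2) and (3.8)–(3.9)] [cite: vanGeemen1994HodgeAV, Thm. 4.3] -/
theorem IsStablyNondegenerate.prod_cmCurve_of_hasNoTypeIVFactor (hA : IsStablyNondegenerate A)
    (hA4 : HasNoTypeIVFactor A) (hE : E.dim = 1) (hEcm : IsOfCMType E) : IsStablyNondegenerate (A.prod E) :=
  hA.prod_of_hasNoTypeIVFactor_of_isOfCMType hA4 hEcm (EllipticCurve.isStablyNondegenerate hE)

/-- **All `A^{M+1} × E^{N+1}` are stably nondegenerate** (`A` without factor of Type IV with (D), `E` a CM elliptic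
curve); so `B(A^{M+1} × E^{N+1}) = D`. [cite: MoonenZarhin1999LowDim, §3 Thm. (3.2)(2) and (3.8)–(3.9)] -/
theorem IsStablyNondegenerate.powSucc_prod_powSucc_cmCurve_of_hasNoTypeIVFactor (hA : IsStablyNondegenerate A)
    (hA4 : HasNoTypeIVFactor A) (hE : E.dim = 1) (hEcm : IsOfCMType E) (M N : ℕ) :
    IsStablyNondegenerate ((A.powSucc M).prod (E.powSucc N)) :=
  (hA.prod_cmCurve_of_hasNoTypeIVFactor hA4 hE hEcm).powSucc_prod_powSucc M N

end SmallCM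

/-! ### §3 Rows: `End⁰ = ℚ` surfaces and threefolds, simple surfaces and threefolds without Type IV, times a CM curve -/

section Rows

variable {S T C E : AbelianVariety ℂ}

/-- **`End⁰(S) = ℚ` ⟹ no factor of Type IV** (`End⁰(S)` is then the totally real field `ℚ`:
`isField_endAlgebra_of_finrank_eq_one`, `isTotallyReal_endField_of_finrank_eq_one`, `hasNoTypeIVFactor_of_isTotallyReal`).
[cite: MoonenZarhin1999LowDim, §1] [cite: MumfordAV1970, §19 Cor. 2 (p. 174)] -/
theorem hasNoTypeIVFactor_of_finrank_endAlgebra_eq_one (h1 : Module.finrank ℚ S.endAlgebra = 1) : HasNoTypeIVFactor S :=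
  haveI := isTotallyReal_endField_of_finrank_eq_one (isField_endAlgebra_of_finrank_eq_one h1) h1
  hasNoTypeIVFactor_of_isTotallyReal S (isField_endAlgebra_of_finrank_eq_one h1)

/-- **THE ROW «surface of Type I(1) × CM elliptic curve» of Moonen–Zarhin Thm. 0.1 (4), PROVED: `S × E` is stably
nondegenerate** for an abelian surface `S` with `End⁰(S) = ℚ` and an elliptic curve `E` with complex multiplication:
every power `(S × E)^{N+1}` has `B = D` (`B(Sⁿ) = D(Sⁿ)`: `Hg(S) = Sp₄`, the tree's
`AbelianVariety.isDivisorGenerated_powSucc_of_surface_endRankOne`; `S` has no factor of Type IV; `E` is of CM type).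
Not an exceptional case of Thm. 0.1: (a) needs an imaginary quadratic field inside `End⁰(S) = ℚ`.
[cite: MoonenZarhin1999LowDim, Thm. 0.1 (4), §2 (2.2) and §3 Thm. (3.2)(2)] [cite: vanGeemen1994HodgeAV, Thm. 4.2 and Thm. 4.3] -/
theorem isStablyNondegenerate_surface_endRankOne_prod_cmCurve (hS1 : Module.finrank ℚ S.endAlgebra = 1)
    (hS2 : S.dim = 2) (hE : E.dim = 1) (hEcm : IsOfCMType E) : IsStablyNondegenerate (S.prod E) :=
  IsStablyNondegenerate.prod_cmCurve_of_hasNoTypeIVFactor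
    (fun N => AbelianVariety.isDivisorGenerated_powSucc_of_surface_endRankOne S hS1 hS2 N)
    (hasNoTypeIVFactor_of_finrank_endAlgebra_eq_one hS1) hE hEcm

/-- **All `S^{M+1} × E^{N+1}` are stably nondegenerate** (`End⁰(S) = ℚ` surface, CM elliptic curve `E`).
[cite: MoonenZarhin1999LowDim, Thm. 0.1 (4) and §3 Thm. (3.2)(2)] -/
theorem isStablyNondegenerate_powSucc_surface_endRankOne_prod_powSucc_cmCurve (hS1 : Module.finrank ℚ S.endAlgebra = 1)
    (hS2 : S.dim = 2) (hE : E.dim = 1) (hEcm : IsOfCMType E) (M N : ℕ) :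
    IsStablyNondegenerate ((S.powSucc M).prod (E.powSucc N)) :=
  (isStablyNondegenerate_surface_endRankOne_prod_cmCurve hS1 hS2 hE hEcm).powSucc_prod_powSucc M N

/-- **`B(S^{M+1} × E^{N+1}) = D(S^{M+1} × E^{N+1})`** (`End⁰(S) = ℚ` surface, CM elliptic curve `E`).
[cite: MoonenZarhin1999LowDim, Thm. 0.1 (4) and §3 Thm. (3.2)(2)] -/
theorem isDivisorGenerated_powSucc_surface_endRankOne_prod_powSucc_cmCurve (hS1 : Module.finrank ℚ S.endAlgebra = 1)
    (hS2 : S.dim = 2) (hE : E.dim = 1) (hEcm : IsOfCMType E) (M N : ℕ) :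
    IsDivisorGenerated ((S.powSucc M).prod (E.powSucc N)) :=
  (isStablyNondegenerate_powSucc_surface_endRankOne_prod_powSucc_cmCurve hS1 hS2 hE hEcm M N).isDivisorGenerated

/-- **The Hodge conjecture for every `S^{M+1} × E^{N+1}`** (`End⁰(S) = ℚ` surface, CM elliptic curve `E`) —
UNCONDITIONAL. [cite: MoonenZarhin1999LowDim, Thm. 0.1 (4) and §2 condition (D)] [cite: vanGeemen1994HodgeAV, §2.4] -/
theorem hodgeConjectureFor_powSucc_surface_endRankOne_prod_powSucc_cmCurve (hS1 : Module.finrank ℚ S.endAlgebra = 1)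
    (hS2 : S.dim = 2) (hE : E.dim = 1) (hEcm : IsOfCMType E) (M N : ℕ) :
    HodgeConjectureFor ((S.powSucc M).prod (E.powSucc N)).dim ((S.powSucc M).prod (E.powSucc N)).X :=
  (isStablyNondegenerate_powSucc_surface_endRankOne_prod_powSucc_cmCurve hS1 hS2 hE hEcm M N).hodgeConjectureFor

/-- **The Hodge conjecture for `S × E` itself** (`End⁰(S) = ℚ` surface, CM elliptic curve).
[cite: MoonenZarhin1999LowDim, Thm. 0.1 (4)] -/
theorem hodgeConjectureFor_surface_endRankOne_prod_cmCurve (hS1 : Module.finrank ℚ S.endAlgebra = 1)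
    (hS2 : S.dim = 2) (hE : E.dim = 1) (hEcm : IsOfCMType E) : HodgeConjectureFor (S.prod E).dim (S.prod E).X :=
  (isStablyNondegenerate_surface_endRankOne_prod_cmCurve hS1 hS2 hE hEcm).hodgeConjectureFor

/-- **The Hodge conjecture for everything isogenous to a power `(S × E)^{N+1}`** (in particular `E × S` and all
`E^a × S^b` up to isogeny). [cite: vanGeemen1994HodgeAV, Lemma 3.7] [cite: MoonenZarhin1999LowDim, Thm. 0.1 (4)] -/
theorem hodgeConjectureFor_of_isIsogenous_powSucc_surface_endRankOne_prod_cmCurve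
    (hS1 : Module.finrank ℚ S.endAlgebra = 1) (hS2 : S.dim = 2) (hE : E.dim = 1) (hEcm : IsOfCMType E)
    {X : AbelianVariety ℂ} {N : ℕ} (hX : AbelianVariety.IsIsogenous X ((S.prod E).powSucc N)) :
    HodgeConjectureFor X.dim X.X :=
  (isStablyNondegenerate_surface_endRankOne_prod_cmCurve hS1 hS2 hE hEcm).hodgeConjectureFor_of_isIsogenous_powSucc hX

/-- **Isogeny invariance of the row**: everything isogenous to `S × E` is stably nondegenerate.
[cite: vanGeemen1994HodgeAV, §3.6 (p. 236)] [cite: MoonenZarhin1999LowDim, Thm. 0.1 (4)] -/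
theorem isStablyNondegenerate_of_isIsogenous_surface_endRankOne_prod_cmCurve
    (hS1 : Module.finrank ℚ S.endAlgebra = 1) (hS2 : S.dim = 2) (hE : E.dim = 1) (hEcm : IsOfCMType E)
    {X : AbelianVariety ℂ} (hX : AbelianVariety.IsIsogenous X (S.prod E)) : IsStablyNondegenerate X :=
  (isStablyNondegenerate_surface_endRankOne_prod_cmCurve hS1 hS2 hE hEcm).of_isIsogenous hX

/-- **The fourfold row `T × E`: `T` an abelian THREEFOLD with `End⁰(T) = ℚ`, `E` a CM elliptic curve — stably
nondegenerate** (`B(Tⁿ) = D(Tⁿ)`: `Hg(T) = Sp₆`, `AbelianVariety.isDivisorGenerated_powSucc_of_threefold_endRankOne`).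
[cite: MoonenZarhin1999LowDim, Thm. 0.1 (4), §2 (2.3) and §3 Thm. (3.2)(2)] [cite: vanGeemen1994HodgeAV, Thm. 4.2 and Thm. 4.3] -/
theorem isStablyNondegenerate_threefold_endRankOne_prod_cmCurve (hT1 : Module.finrank ℚ T.endAlgebra = 1)
    (hT3 : T.dim = 3) (hE : E.dim = 1) (hEcm : IsOfCMType E) : IsStablyNondegenerate (T.prod E) :=
  IsStablyNondegenerate.prod_cmCurve_of_hasNoTypeIVFactor
    (fun N => AbelianVariety.isDivisorGenerated_powSucc_of_threefold_endRankOne T hT1 hT3 N)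
    (hasNoTypeIVFactor_of_finrank_endAlgebra_eq_one hT1) hE hEcm

/-- **All `T^{M+1} × E^{N+1}` are stably nondegenerate** (`End⁰(T) = ℚ` threefold, CM elliptic curve).
[cite: MoonenZarhin1999LowDim, Thm. 0.1 (4) and §3 Thm. (3.2)(2)] -/
theorem isStablyNondegenerate_powSucc_threefold_endRankOne_prod_powSucc_cmCurve
    (hT1 : Module.finrank ℚ T.endAlgebra = 1) (hT3 : T.dim = 3) (hE : E.dim = 1) (hEcm : IsOfCMType E) (M N : ℕ) :
    IsStablyNondegenerate ((T.powSucc M).prod (E.powSucc N)) :=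
  (isStablyNondegenerate_threefold_endRankOne_prod_cmCurve hT1 hT3 hE hEcm).powSucc_prod_powSucc M N

/-- **The Hodge conjecture for every `T^{M+1} × E^{N+1}`** (`End⁰(T) = ℚ` threefold, CM elliptic curve) — UNCONDITIONAL.
[cite: MoonenZarhin1999LowDim, Thm. 0.1 (4) and §2 condition (D)] [cite: vanGeemen1994HodgeAV, §2.4] -/
theorem hodgeConjectureFor_powSucc_threefold_endRankOne_prod_powSucc_cmCurve
    (hT1 : Module.finrank ℚ T.endAlgebra = 1) (hT3 : T.dim = 3) (hE : E.dim = 1) (hEcm : IsOfCMType E) (M N : ℕ) :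
    HodgeConjectureFor ((T.powSucc M).prod (E.powSucc N)).dim ((T.powSucc M).prod (E.powSucc N)).X :=
  (isStablyNondegenerate_powSucc_threefold_endRankOne_prod_powSucc_cmCurve hT1 hT3 hE hEcm M N).hodgeConjectureFor

/-- **`S × C`, `S` a surface with `End⁰(S) = ℚ`, `C` simple of CM type of dimension `≤ 3`** (a CM elliptic curve, a
simple CM surface, a simple CM threefold) is stably nondegenerate. [cite: MoonenZarhin1999LowDim, §3 Thm. (3.2)(2) and §5 (5.2)]
[cite: Pohlmann1968, Thm. 2] -/
theorem isStablyNondegenerate_surface_endRankOne_prod_of_isSimple_of_isOfCMType_of_dim_le_three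
    (hS1 : Module.finrank ℚ S.endAlgebra = 1) (hS2 : S.dim = 2) (hs : C.IsSimple) (h0 : 0 < C.dim) (h3 : C.dim ≤ 3)
    (hcm : IsOfCMType C) : IsStablyNondegenerate (S.prod C) :=
  IsStablyNondegenerate.prod_of_hasNoTypeIVFactor_of_isSimple_of_isOfCMType_of_dim_le_three
    (fun N => AbelianVariety.isDivisorGenerated_powSucc_of_surface_endRankOne S hS1 hS2 N)
    (hasNoTypeIVFactor_of_finrank_endAlgebra_eq_one hS1) hs h0 h3 hcm

/-- **`T × C`, `T` a threefold with `End⁰(T) = ℚ`, `C` simple of CM type of dimension `≤ 3`** is stably nondegenerate.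
[cite: MoonenZarhin1999LowDim, §3 Thm. (3.2)(2) and §5 (5.2)] [cite: Pohlmann1968, Thm. 2] -/
theorem isStablyNondegenerate_threefold_endRankOne_prod_of_isSimple_of_isOfCMType_of_dim_le_three
    (hT1 : Module.finrank ℚ T.endAlgebra = 1) (hT3 : T.dim = 3) (hs : C.IsSimple) (h0 : 0 < C.dim) (h3 : C.dim ≤ 3)
    (hcm : IsOfCMType C) : IsStablyNondegenerate (T.prod C) :=
  IsStablyNondegenerate.prod_of_hasNoTypeIVFactor_of_isSimple_of_isOfCMType_of_dim_le_three
    (fun N => AbelianVariety.isDivisorGenerated_powSucc_of_threefold_endRankOne T hT1 hT3 N)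
    (hasNoTypeIVFactor_of_finrank_endAlgebra_eq_one hT1) hs h0 h3 hcm

/-- **A SIMPLE abelian surface without factor of Type IV (Types I(1), I(2), II(1)) times a CM elliptic curve is
stably nondegenerate** (`B(Sⁿ) = D(Sⁿ)` for every simple surface: `AbelianVariety.isStablyNondegenerate_of_isSimple_surface`).
[cite: MoonenZarhin1999LowDim, Thm. 0.1 (4), §2 (2.2) and §3 Thm. (3.2)(2)] -/
theorem isStablyNondegenerate_prod_cmCurve_of_isSimple_surface_of_hasNoTypeIVFactor (hS : S.IsSimple)
    (hS2 : S.dim = 2) (hS4 : HasNoTypeIVFactor S) (hE : E.dim = 1) (hEcm : IsOfCMType E) :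
    IsStablyNondegenerate (S.prod E) :=
  (AbelianVariety.isStablyNondegenerate_of_isSimple_surface S hS hS2).prod_cmCurve_of_hasNoTypeIVFactor hS4 hE hEcm

/-- **A SIMPLE abelian threefold without factor of Type IV times a CM elliptic curve is stably nondegenerate**
(`B(Tⁿ) = D(Tⁿ)` for every simple threefold: `AbelianVariety.isStablyNondegenerate_of_isSimple_of_dim_three`).
[cite: MoonenZarhin1999LowDim, Thm. 0.1 (4), §2 (2.3) and §3 Thm. (3.2)(2)] -/
theorem isStablyNondegenerate_prod_cmCurve_of_isSimple_threefold_of_hasNoTypeIVFactor (hT : T.IsSimple)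
    (hT3 : T.dim = 3) (hT4 : HasNoTypeIVFactor T) (hE : E.dim = 1) (hEcm : IsOfCMType E) :
    IsStablyNondegenerate (T.prod E) :=
  (AbelianVariety.isStablyNondegenerate_of_isSimple_of_dim_three T hT hT3).prod_cmCurve_of_hasNoTypeIVFactor hT4 hE hEcm

end Rows

end Literature.AlgebraicGeometry.HodgeTheory
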